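import Literature.RepresentationTheory.HeisenbergGroup.SchrodingerGaloisTwist
import Literature.RepresentationTheory.TwistedCoinvariantsSemilinear
import HarnessLib

/-!
# Galois twist of the twisted coinvariants of a splitting: `Θ_s(ξ)^σ ≃ Θ_{σ·s}(σ ∘ ξ)` (semilinear, equivariant)

Topic `RepresentationTheory/HeisenbergGroup`; namespace `Literature.RepresentationTheory.HeisenbergGroup`.
KERNEL ONLY: theorems (no definition, no named fact, no `sorry`), composing `SchrodingerGaloisTwist.lean` (the
`τ`-twist `galTwist` of the metaplectic group of pairs of the smooth Schrödinger model, `ψ ↦ ψ' = τ ∘ ψ`) with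
`TwistedCoinvariantsSemilinear.lean` (`TwistedCoinv.mapₛₗ`).

SETTING.  `ρ_ψ = schrodingerSB β ψ` on `𝒮(X)`, `ψ' = τ ∘ ψ`, `τ' = τ⁻¹` (two ring endomorphisms of `ℂ`, mutually inverse);
two homomorphisms `s : G →* S̃p_ψ(W)` and `z : H →* S̃p_ψ(W)` (a dual pair: `G = U(V)`, `H = U(W)` or the centre) whose
Weil representations `ω_s = ω ∘ s`, `ω_z = ω ∘ z` commute, and a character `ξ : H →* ℂˣ`.  The `ξ`-coinvariants
`Θ_s(ξ) := Coinv ω_z ξ` carry the `G`-action `rep ξ ω_s`.  THE STATEMENT (`exists_semilinear_coinv_galTwist`): there is a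
`τ`-SEMILINEAR BIJECTION `Θ_s(ξ) → Θ_{galTwist∘s}(ξ')`, `ξ' = τ ∘ ξ`, intertwining the `G`-actions — induced by
`f ↦ τ ∘ f` on `𝒮(X)` (`schwartzGalConj`), which intertwines `ω_s` with `ω_{galTwist∘s}` and `ω_z` with `ω_{galTwist∘z}`
on the nose (`MpPsi.toRep_galTwist_comp_apply`).  In words: **the Galois twist of a local theta lift is the theta lift,
for the Galois-twisted oscillator representation, of the Galois-twisted character** — the representation-theoretic
core of [Liu2021, Thm 4.18 (3)] (proof l. 2272–2289: «`ω(μ,ε,χ)^σ` is a summand of the same family»), prior to the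
identification `ψ' = ψ(κ·) ↔ ⟨κ a⟩` (pieces P4/P3b of the cell `hodgecm-mathlib`'s road, other files).  Also the
non-vanishing transfer (`nontrivial_coinv_galTwist_iff`).
HC_CM is proved only modulo the 7 printed citations until rung 0 of the ladder closes; nothing about it is claimed here.

## References
* [Liu2021] Y. Liu, Camb. J. Math. 9 (2021), Thm. 4.18 (3), proof l. 2272–2289; App. D §D.1 Step 3.
* [MoeglinVignerasWaldspurger1987] C. Mœglin, M.-F. Vignéras, J.-L. Waldspurger, LNM 1291 (1987), Chap. 2 II.1,
  Chap. 3 IV (maximal isotypic quotients `Θ(π)`).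
-/

set_option autoImplicit false

noncomputable section

namespace Literature.RepresentationTheory.HeisenbergGroup

open Literature.NumberTheory.Automorphic (SchwartzBruhat)
open Literature.RepresentationTheory (TwistedCoinv.Coinv TwistedCoinv.rep TwistedCoinv.mapₛₗ)

universe u v w

variable {R : Type u} [CommRing R] [Invertible (2 : R)] {X : Type v} {Y : Type w} [AddCommGroup X] [Module R X]
  [AddCommGroup Y] [Module R Y] (β : X →ₗ[R] Y →ₗ[R] R) [TopologicalSpace X] [TopologicalSpace R]
  [IsTopologicalAddGroup X] (ψ ψ' : AddChar R Circle) (hl : IsLocallyConstant (⇑ψ : R → Circle))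
  (hl' : IsLocallyConstant (⇑ψ' : R → Circle)) (hb : ∀ y : Y, Continuous fun u : X => β u y)
  (τ τ' : ℂ →+* ℂ) (hττ' : ∀ z, τ (τ' z) = z) (hτ'τ : ∀ z, τ' (τ z) = z)
  (hτ : ∀ r : R, τ ((ψ r : Circle) : ℂ) = ((ψ' r : Circle) : ℂ))
  {G H : Type*} [Group G] [Group H]

/-- **reverse intertwining**: `τ' ∘ ·` carries `ω_{galTwist∘z}` back to `ω_z`. [cite: MoeglinVignerasWaldspurger1987, Chap. 2 II.1 (B)] -/
theorem toRep_comp_apply_schwartzGalConj_symm (z : H →* MpPsi (schrodingerSB β ψ hl hb)) (h : H)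
    (w : SchwartzBruhat X) :
    (MpPsi.toRep (schrodingerSB β ψ hl hb)).comp z h (schwartzGalConj τ' w) =
      schwartzGalConj τ' ((MpPsi.toRep (schrodingerSB β ψ' hl' hb)).comp
        ((MpPsi.galTwist β ψ ψ' hl hl' hb τ τ' hττ' hτ'τ hτ).comp z) h w) := by
  apply schwartzGalConj_injective τ
  rw [schwartzGalConj_schwartzGalConj τ τ' hττ',
    ← MpPsi.toRep_galTwist_comp_apply β ψ ψ' hl hl' hb τ τ' hττ' hτ'τ hτ z h (schwartzGalConj τ' w),
    schwartzGalConj_schwartzGalConj τ τ' hττ']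

/-- **THE GALOIS TWIST OF A THETA LIFT.**  For commuting Weil representations `ω_s` (of `G`) and `ω_z` (of `H`) of two
homomorphisms into `S̃p_ψ(W)`, a character `ξ` of `H` and `ξ' = τ ∘ ξ`: the map `f ↦ τ ∘ f` of `𝒮(X)` descends to a
`τ`-semilinear BIJECTION of coinvariants `Coinv ω_z ξ → Coinv ω_{galTwist∘z} ξ'` intertwining `rep ξ ω_s` with
`rep ξ' ω_{galTwist∘s}`. [cite: Liu2021, Thm 4.18 (3) proof l. 2272–2289] [cite: MoeglinVignerasWaldspurger1987, Chap. 3 IV] -/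
theorem exists_semilinear_coinv_galTwist (s : G →* MpPsi (schrodingerSB β ψ hl hb))
    (z : H →* MpPsi (schrodingerSB β ψ hl hb))
    (hc : ∀ (g : G) (h : H), Commute ((MpPsi.toRep (schrodingerSB β ψ hl hb)).comp s g)
      ((MpPsi.toRep (schrodingerSB β ψ hl hb)).comp z h))
    (hc' : ∀ (g : G) (h : H),
      Commute ((MpPsi.toRep (schrodingerSB β ψ' hl' hb)).comp ((MpPsi.galTwist β ψ ψ' hl hl' hb τ τ' hττ' hτ'τ hτ).comp s) g)
        ((MpPsi.toRep (schrodingerSB β ψ' hl' hb)).comp ((MpPsi.galTwist β ψ ψ' hl hl' hb τ τ' hττ' hτ'τ hτ).comp z) h))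
    (ξ ξ' : H →* ℂˣ) (hξ : ∀ h : H, ((ξ' h : ℂˣ) : ℂ) = τ ((ξ h : ℂˣ) : ℂ)) :
    ∃ f : TwistedCoinv.Coinv ((MpPsi.toRep (schrodingerSB β ψ hl hb)).comp z) ξ →ₛₗ[τ]
        TwistedCoinv.Coinv ((MpPsi.toRep (schrodingerSB β ψ' hl' hb)).comp
          ((MpPsi.galTwist β ψ ψ' hl hl' hb τ τ' hττ' hτ'τ hτ).comp z)) ξ',
      Function.Bijective f ∧
      (∀ v : SchwartzBruhat X, f (TwistedCoinv.mk _ ξ v) = TwistedCoinv.mk _ ξ' (schwartzGalConj τ v)) ∧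
      ∀ (g : G) (x : TwistedCoinv.Coinv ((MpPsi.toRep (schrodingerSB β ψ hl hb)).comp z) ξ),
        f (TwistedCoinv.rep ξ ((MpPsi.toRep (schrodingerSB β ψ hl hb)).comp s) hc g x) =
          TwistedCoinv.rep ξ' ((MpPsi.toRep (schrodingerSB β ψ' hl' hb)).comp
            ((MpPsi.galTwist β ψ ψ' hl hl' hb τ τ' hττ' hτ'τ hτ).comp s)) hc' g (f x) := by
  -- the semilinear intertwiner `T = (τ ∘ ·)` and its inverse `T' = (τ' ∘ ·)`
  have hT : ∀ (h : H) (v : SchwartzBruhat X),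
      (MpPsi.toRep (schrodingerSB β ψ' hl' hb)).comp ((MpPsi.galTwist β ψ ψ' hl hl' hb τ τ' hττ' hτ'τ hτ).comp z) h
          (schwartzGalConj τ v) =
        schwartzGalConj τ ((MpPsi.toRep (schrodingerSB β ψ hl hb)).comp z h v) :=
    fun h v => MpPsi.toRep_galTwist_comp_apply β ψ ψ' hl hl' hb τ τ' hττ' hτ'τ hτ z h v
  have hT' : ∀ (h : H) (w : SchwartzBruhat X),
      (MpPsi.toRep (schrodingerSB β ψ hl hb)).comp z h (schwartzGalConj τ' w) =
        schwartzGalConj τ' ((MpPsi.toRep (schrodingerSB β ψ' hl' hb)).comp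
          ((MpPsi.galTwist β ψ ψ' hl hl' hb τ τ' hττ' hτ'τ hτ).comp z) h w) :=
    fun h w => toRep_comp_apply_schwartzGalConj_symm β ψ ψ' hl hl' hb τ τ' hττ' hτ'τ hτ z h w
  have hξ' : ∀ h : H, ((ξ h : ℂˣ) : ℂ) = τ' ((ξ' h : ℂˣ) : ℂ) := fun h => by rw [hξ, hτ'τ]
  refine ⟨TwistedCoinv.mapₛₗ _ ξ _ ξ' (schwartzGalConj τ) hT hξ,
    TwistedCoinv.mapₛₗ_bijective _ ξ _ ξ' (schwartzGalConj τ) hT hξ (schwartzGalConj τ') hT' hξ'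
      (schwartzGalConj_schwartzGalConj τ' τ hτ'τ) (schwartzGalConj_schwartzGalConj τ τ' hττ'),
    fun v => rfl, fun g x => ?_⟩
  exact (TwistedCoinv.mapₛₗ_rep_of_intertwine _ ξ _ ξ' _ _ hc hc' (schwartzGalConj τ) hT hξ
    (fun g v => MpPsi.toRep_galTwist_comp_apply β ψ ψ' hl hl' hb τ τ' hττ' hτ'τ hτ s g v) g x).symm

/-- **non-vanishing transfers under the Galois twist**: `Θ_s(ξ) ≠ 0 ↔ Θ_{galTwist∘s}(τ ∘ ξ) ≠ 0`.
[cite: Liu2021, Thm 4.18 (3) proof l. 2272–2289] -/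
theorem nontrivial_coinv_galTwist_iff (z : H →* MpPsi (schrodingerSB β ψ hl hb))
    (ξ ξ' : H →* ℂˣ) (hξ : ∀ h : H, ((ξ' h : ℂˣ) : ℂ) = τ ((ξ h : ℂˣ) : ℂ)) :
    Nontrivial (TwistedCoinv.Coinv ((MpPsi.toRep (schrodingerSB β ψ hl hb)).comp z) ξ) ↔
      Nontrivial (TwistedCoinv.Coinv ((MpPsi.toRep (schrodingerSB β ψ' hl' hb)).comp
        ((MpPsi.galTwist β ψ ψ' hl hl' hb τ τ' hττ' hτ'τ hτ).comp z)) ξ') := by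
  have hT : ∀ (h : H) (v : SchwartzBruhat X),
      (MpPsi.toRep (schrodingerSB β ψ' hl' hb)).comp ((MpPsi.galTwist β ψ ψ' hl hl' hb τ τ' hττ' hτ'τ hτ).comp z) h
          (schwartzGalConj τ v) =
        schwartzGalConj τ ((MpPsi.toRep (schrodingerSB β ψ hl hb)).comp z h v) :=
    fun h v => MpPsi.toRep_galTwist_comp_apply β ψ ψ' hl hl' hb τ τ' hττ' hτ'τ hτ z h v
  have hT' : ∀ (h : H) (w : SchwartzBruhat X),
      (MpPsi.toRep (schrodingerSB β ψ hl hb)).comp z h (schwartzGalConj τ' w) =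
        schwartzGalConj τ' ((MpPsi.toRep (schrodingerSB β ψ' hl' hb)).comp
          ((MpPsi.galTwist β ψ ψ' hl hl' hb τ τ' hττ' hτ'τ hτ).comp z) h w) :=
    fun h w => toRep_comp_apply_schwartzGalConj_symm β ψ ψ' hl hl' hb τ τ' hττ' hτ'τ hτ z h w
  have hξ' : ∀ h : H, ((ξ h : ℂˣ) : ℂ) = τ' ((ξ' h : ℂˣ) : ℂ) := fun h => by rw [hξ, hτ'τ]
  exact TwistedCoinv.nontrivial_iff_of_mapₛₗ_bijective _ ξ _ ξ' (schwartzGalConj τ) hT hξ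
    (TwistedCoinv.mapₛₗ_bijective _ ξ _ ξ' (schwartzGalConj τ) hT hξ (schwartzGalConj τ') hT' hξ'
      (schwartzGalConj_schwartzGalConj τ' τ hτ'τ) (schwartzGalConj_schwartzGalConj τ τ' hττ'))


/-! ## §2 The dual-pair shape: the second member acts through a homomorphism `c : H →* G` -/

/-- commutation in the group transfers to commuting Weil operators, for ANY splitting `s : G →* S̃p_ψ(W)`.
[cite: MoeglinVignerasWaldspurger1987, Chap. 2 II.1 (B)] -/
theorem commute_toRep_comp_of_commute {B' V : Type*} [Group B'] [AddCommGroup V] [Module ℂ V]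
    (ρ : Representation ℂ B' V) (s : G →* B') (c : H →* G) (hgc : ∀ (g : G) (h : H), Commute g (c h))
    (g : G) (h : H) :
    Commute (ρ.comp s g) (ρ.comp (s.comp c) h) := by
  rw [MonoidHom.comp_apply, MonoidHom.comp_apply, MonoidHom.comp_apply]
  exact ((hgc g h).map s).map ρ

/-- **THE GALOIS TWIST OF A THETA LIFT, dual-pair shape.**  When the second member `H` acts through a homomorphism
`c : H →* G` whose image commutes with everything (`hgc`; e.g. `c = localCenter`, the compact member `U(W) = E¹` of a
rank-one unitary dual pair sitting in the centre of `U(V ⊗ W)(F_v)`), both commutation hypotheses of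
`exists_semilinear_coinv_galTwist` are automatic: for every splitting `s : G →* S̃p_ψ(W)` and character `ξ` of `H` there
is a `τ`-semilinear bijection `Coinv (ω_s ∘ c) ξ → Coinv (ω_{galTwist∘s} ∘ c) (τ ∘ ξ)`, `f (mk v) = mk (τ ∘ v)`,
intertwining the `G`-actions `rep ξ ω_s` and `rep (τ∘ξ) ω_{galTwist∘s}`.
[cite: Liu2021, Thm 4.18 (3) proof l. 2272–2289] [cite: MoeglinVignerasWaldspurger1987, Chap. 3 IV] -/
theorem exists_semilinear_coinv_galTwist_of_commute (s : G →* MpPsi (schrodingerSB β ψ hl hb)) (c : H →* G)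
    (hgc : ∀ (g : G) (h : H), Commute g (c h)) (ξ ξ' : H →* ℂˣ)
    (hξ : ∀ h : H, ((ξ' h : ℂˣ) : ℂ) = τ ((ξ h : ℂˣ) : ℂ)) :
    ∃ f : TwistedCoinv.Coinv ((MpPsi.toRep (schrodingerSB β ψ hl hb)).comp (s.comp c)) ξ →ₛₗ[τ]
        TwistedCoinv.Coinv ((MpPsi.toRep (schrodingerSB β ψ' hl' hb)).comp
          (((MpPsi.galTwist β ψ ψ' hl hl' hb τ τ' hττ' hτ'τ hτ).comp s).comp c)) ξ',
      Function.Bijective f ∧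
      (∀ v : SchwartzBruhat X, f (TwistedCoinv.mk _ ξ v) = TwistedCoinv.mk _ ξ' (schwartzGalConj τ v)) ∧
      ∀ (g : G) (x : TwistedCoinv.Coinv ((MpPsi.toRep (schrodingerSB β ψ hl hb)).comp (s.comp c)) ξ),
        f (TwistedCoinv.rep ξ ((MpPsi.toRep (schrodingerSB β ψ hl hb)).comp s)
            (commute_toRep_comp_of_commute _ s c hgc) g x) =
          TwistedCoinv.rep ξ' ((MpPsi.toRep (schrodingerSB β ψ' hl' hb)).comp
              ((MpPsi.galTwist β ψ ψ' hl hl' hb τ τ' hττ' hτ'τ hτ).comp s))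
            (commute_toRep_comp_of_commute _ _ c hgc) g (f x) :=
  exists_semilinear_coinv_galTwist β ψ ψ' hl hl' hb τ τ' hττ' hτ'τ hτ s (s.comp c)
    (commute_toRep_comp_of_commute _ s c hgc) (commute_toRep_comp_of_commute _ _ c hgc) ξ ξ' hξ

end Literature.RepresentationTheory.HeisenbergGroup

end
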